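import Summits.ResolutionOfSingularities.ResolutionOfSingularities.Theorems.PurelyInseparableDim4ParamCertSevenExt
import HarnessLib

/-!
# [OURS · res-dim4-pi · F4-C-loc] PARAMETRIC CERTIFICATES, format v8: the QUADRATIC PIN row — the fibre letter pinned to a
  root of an irreducible quadratic whose reduced family is RATIONAL again (ambiguous low coefficients vanishing at `β² = −1`)

Cell `res-dim4-pi` (D-0157 DOOR 2, wave 2), seat `res-dim4-p-6` g4; sequel of `…ParamCertSeven(Ext)`.  The v7 `pin` row reads a
low coefficient `A·T^{d₀}·∏(T − ρ)^m`; here the factorisation may also carry quadratic factors `T² − c₁T − c₀`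
(`rootsPolyL A d₀ rts qds`): either the coefficient is non-zero at `β` (terminal position), or `β = f ρ` (pinned rational row
`normT (pinT ρ L)`), or `β` is a root of a listed quadratic — then `spec f β (evalT L) = spec f β (evalT (reduceQ c₁ c₀ L))`
(`ParamLift.spec_reduceQ`) and the reduced list, REQUIRED LETTER-FREE, is a later row.  Rows: `seven c` (a v7 row, checked by
`prow7EB` against the projected later rows and the external rows) | `pinq γ d₀ A rts qds`; checker **`pcert8B q ext T`**,
soundness **`pwin_of_pcert8B`**, chaining **`rows_certified_of_pcert8B`**, entry **`rWins_liftState_of_pcert8B`**.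

[OURS · counted 0 · certificate format + soundness; AI kernel work, weaker than expert review.]  NOTHING here is a statement
about resolution of singularities; resolution in dimension `≥ 4` / characteristic `p > 0` is NOT proved by anything in this
file.  bears_on: LADDER-RESOLUTION:D157-DOOR2 (res-dim4-pi · F4-C-loc all fields · rows v8).  Host item (DR-157-C):
`stmt-ResolutionOfSingularities-16155`, helper.
-/

set_option linter.dupNamespace false -- mandated namespace of this single-conjunct summit

noncomputable section

open MvPolynomial Finset
open scoped BigOperators

namespace Summit.ResolutionOfSingularities.ResolutionOfSingularities.Theorems.PIDim4

namespace LoopCLocal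

open Literature.AlgebraicGeometry.Resolution
open Literature.AlgebraicGeometry.Resolution.Hauser2010
open Literature.AlgebraicGeometry.Resolution.CentreBlowup
open StepKit ParamLift

section Format

variable {k : Type} [Field k] [DecidableEq k]

/-! ## §1 The format -/

/-- a v8 row certificate. OURS. [folklore] -/
inductive PRowCert8 (k : Type) : Type
  /-- a v7 row (six | torus | pin) -/
  | seven (c : PRowCert7 k)
  /-- the letter pinned by the low exponent `γ`: coefficient `A·T^{d₀}·∏(T−ρ)^m·∏(T²−c₁T−c₀)^m`; rational pins and rational
  reductions are later rows -/
  | pinq (γ : Fin 4 → ℕ) (d₀ : ℕ) (A : k) (rts : List (k × ℕ)) (qds : List (k × k × ℕ))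

/-- a v8 row. OURS. [folklore] -/
abbrev PRow8 (k : Type) : Type := Terms 5 k × PRowCert8 k

/-- projection to v7 rows (dummy certificates; only the term lists are read). OURS. [folklore] -/
def proj7 (rest : List (PRow8 k)) : List (PRow7 k) :=
  rest.map fun r => (r.1, PRowCert7.six (PRowCert6.move ∅ fun _ => PNode6.child))

/-- the v8 row check (with external rows). OURS. [folklore] -/
def prow8B (q : ℕ) (ext : List (Terms 5 k)) (rest : List (PRow8 k)) : PRow8 k → Bool
  | (L, PRowCert8.seven c) => prow7EB q ext (proj7 rest) (L, c)
  | (L, PRowCert8.pinq γ d₀ A rts qds) =>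
      !decide (γ = 0) && decide (∑ i, γ i < q) && !decide (A = 0) &&
        decide (∀ t ∈ L, Fin.init t.1 = γ → t.1 (Fin.last 4) < (rootsPolyL A d₀ rts qds).length) &&
        ((List.range (rootsPolyL A d₀ rts qds).length).all fun a =>
          decide (tCoef γ L a = (rootsPolyL A d₀ rts qds).getD a 0)) &&
        decide (∀ ρm ∈ rts, memRow6B (normT (pinT ρm.1 L)) (proj6 (proj7 rest) ++ ext6 ext) = true) &&
        decide (∀ c ∈ qds, tfreeB (normT (reduceQ c.1 c.2.1 L)) = true ∧
          memRow6B (normT (reduceQ c.1 c.2.1 L)) (proj6 (proj7 rest) ++ ext6 ext) = true)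

/-- **the v8 checker** (with external rows). OURS. [folklore] -/
def pcert8B (q : ℕ) (ext : List (Terms 5 k)) : List (PRow8 k) → Bool
  | [] => true
  | row :: rest => prow8B q ext rest row && pcert8B q ext rest

end Format

/-! ## §2 Soundness -/

section Sound

variable {k K : Type} [Field k] [Field K] [DecidableEq k] [DecidableEq K] (f : k →+* K)

omit [DecidableEq k] in
/-- the induction hypothesis descends to the v7 projection. OURS. [folklore] -/
theorem hrest_proj7 {q : ℕ} {rest : List (PRow8 k)}
    (hrest : ∀ row ∈ rest, (∀ β : K, β ≠ 0 → ∀ (r : Fin 4 →₀ ℕ) (exc : Finset (Fin 4)),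
      RWins q localB (⟨spec f β (evalT row.1), r, exc⟩ : State K))) :
    ∀ row ∈ proj7 rest, (∀ β : K, β ≠ 0 → ∀ (r : Fin 4 →₀ ℕ) (exc : Finset (Fin 4)),
      RWins q localB (⟨spec f β (evalT row.1), r, exc⟩ : State K)) := by
  intro row hrow
  unfold proj7 at hrow
  obtain ⟨r, hr, rfl⟩ := List.mem_map.mp hrow
  exact hrest r hr

omit [DecidableEq K] in
/-- a letter-free list specialises independently of the letter value (via `spec_eq_of_tfree`). OURS. [folklore] -/
theorem spec_normT_reduceQ_of_root {c₁ c₀ : k} {β : K} (hx : β ^ 2 = f c₁ * β + f c₀) (L : Terms 5 k) :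
    spec f β (evalT L) = spec f β (evalT (normT (reduceQ c₁ c₀ L))) := by
  rw [evalT_normT, spec_reduceQ f c₁ c₀ hx]

/-- **soundness of a QUADRATIC PIN row** against any certified v6 row list. OURS. [folklore] -/
theorem pwin_of_pinq6 {q : ℕ} {rows : List (PRow6 k)}
    (hrows : ∀ row ∈ rows, (∀ β : K, β ≠ 0 → ∀ (r : Fin 4 →₀ ℕ) (exc : Finset (Fin 4)),
      RWins q localB (⟨spec f β (evalT row.1), r, exc⟩ : State K))) {L : Terms 5 k} {γ : Fin 4 → ℕ} {A : k}
    {d₀ : ℕ} {rts : List (k × ℕ)} {qds : List (k × k × ℕ)} (hγq : ∑ i, γ i < q) (hA : A ≠ 0)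
    (hM : ∀ t ∈ L, Fin.init t.1 = γ → t.1 (Fin.last 4) < (rootsPolyL A d₀ rts qds).length)
    (hcoef : ∀ a, a < (rootsPolyL A d₀ rts qds).length → tCoef γ L a = (rootsPolyL A d₀ rts qds).getD a 0)
    (hpins : ∀ ρm ∈ rts, memRow6B (normT (pinT ρm.1 L)) rows = true)
    (hquads : ∀ c ∈ qds, tfreeB (normT (reduceQ c.1 c.2.1 L)) = true ∧
      memRow6B (normT (reduceQ c.1 c.2.1 L)) rows = true)
    {β : K} (hβ : β ≠ 0) (r : Fin 4 →₀ ℕ) (exc : Finset (Fin 4)) :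
    RWins q localB (⟨spec f β (evalT L), r, exc⟩ : State K) := by
  set R := rootsPolyL A d₀ rts qds with hR
  have hco : coeff (expo γ) (spec f β (evalT L)) = evalL f R β := by
    rw [coeff_spec_eq_sum_tCoef f β γ R.length L hM, evalL_eq_sum]
    exact Finset.sum_congr rfl fun a ha => by rw [hcoef a (Finset.mem_range.mp ha)]
  by_cases hzero : evalL f R β = 0
  · rcases root_cases_of_eval_eq_zero f hA hzero with ⟨-, hβ0⟩ | ⟨ρm, hρm, hβρ⟩ | ⟨c, hc, hβc⟩
    · exact absurd hβ0 hβ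
    · rw [hβρ, spec_pin_eq f ρm.1 β L, ← evalT_normT]
      exact pwin_of_memRow6B f hrows (hpins ρm hρm) β hβ r exc
    · rw [spec_normT_reduceQ_of_root f hβc L]
      exact pwin_of_memRow6B f hrows (hquads c hc).2 β hβ r exc
  · rw [← hco] at hzero
    exact Game.Wins.terminal fun S hS => not_isPermissibleCentre_of_coeff_ne_zero hγq hzero S hS.2

/-- **soundness of one v8 row** (external rows certified by `hext`). OURS. [folklore] -/
theorem pwin_of_prow8B {q : ℕ} (hq : 2 ≤ q) {ext : List (Terms 5 k)} {rest : List (PRow8 k)}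
    (hrest : ∀ row ∈ rest, (∀ β : K, β ≠ 0 → ∀ (r : Fin 4 →₀ ℕ) (exc : Finset (Fin 4)),
      RWins q localB (⟨spec f β (evalT row.1), r, exc⟩ : State K)))
    (hext : ∀ L ∈ ext, (∀ β : K, β ≠ 0 → ∀ (r : Fin 4 →₀ ℕ) (exc : Finset (Fin 4)),
      RWins q localB (⟨spec f β (evalT L), r, exc⟩ : State K))) {row : PRow8 k}
    (h : prow8B q ext rest row = true) :
    (∀ β : K, β ≠ 0 → ∀ (r : Fin 4 →₀ ℕ) (exc : Finset (Fin 4)),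
      RWins q localB (⟨spec f β (evalT row.1), r, exc⟩ : State K)) := by
  have hrest7 := hrest_proj7 f hrest
  obtain ⟨L, cert⟩ := row
  intro β hβ r exc
  cases cert with
  | seven c =>
    simp only [prow8B] at h
    exact pwin_of_prow7EB f hq hrest7 hext h β hβ r exc
  | pinq γ d₀ A rts qds =>
    simp only [prow8B, Bool.and_eq_true, Bool.not_eq_true', decide_eq_false_iff_not, decide_eq_true_eq,
      List.all_eq_true, List.mem_range] at h
    obtain ⟨⟨⟨⟨⟨⟨-, hγq⟩, hA⟩, hM⟩, hcoef⟩, hpins⟩, hquads⟩ := h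
    exact pwin_of_pinq6 f (hrest_append f hrest7 hext) hγq hA hM hcoef hpins hquads hβ r exc

/-- **SOUNDNESS OF v8 CERTIFICATES** (external rows certified by `hext`). OURS. [folklore] -/
theorem pwin_of_pcert8B {q : ℕ} (hq : 2 ≤ q) {ext : List (Terms 5 k)}
    (hext : ∀ L ∈ ext, (∀ β : K, β ≠ 0 → ∀ (r : Fin 4 →₀ ℕ) (exc : Finset (Fin 4)),
      RWins q localB (⟨spec f β (evalT L), r, exc⟩ : State K))) :
    ∀ {T : List (PRow8 k)}, pcert8B q ext T = true → ∀ row ∈ T,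
      (∀ β : K, β ≠ 0 → ∀ (r : Fin 4 →₀ ℕ) (exc : Finset (Fin 4)),
        RWins q localB (⟨spec f β (evalT row.1), r, exc⟩ : State K))
  | [], _ => fun row hrow => absurd hrow List.not_mem_nil
  | row :: rest, h => by
    unfold pcert8B at h
    rw [Bool.and_eq_true] at h
    have hrest := pwin_of_pcert8B hq hext h.2
    intro r hr
    rcases List.mem_cons.mp hr with rfl | hr'
    · exact pwin_of_prow8B f hq hrest hext h.1
    · exact hrest r hr'

/-- **chaining form**: the term lists of a checked v8 table are certified. OURS. [folklore] -/
theorem rows_certified_of_pcert8B {q : ℕ} (hq : 2 ≤ q) {ext : List (Terms 5 k)}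
    (hext : ∀ L ∈ ext, (∀ β : K, β ≠ 0 → ∀ (r : Fin 4 →₀ ℕ) (exc : Finset (Fin 4)),
      RWins q localB (⟨spec f β (evalT L), r, exc⟩ : State K))) {T : List (PRow8 k)} (h : pcert8B q ext T = true) :
    ∀ L ∈ T.map Prod.fst, (∀ β : K, β ≠ 0 → ∀ (r : Fin 4 →₀ ℕ) (exc : Finset (Fin 4)),
      RWins q localB (⟨spec f β (evalT L), r, exc⟩ : State K)) := by
  intro L hL
  obtain ⟨row, hrow, rfl⟩ := List.mem_map.mp hL
  exact pwin_of_pcert8B f hq hext h row hrow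

end Sound

/-! ## §3 Entry point -/

/-- **an `𝔽₃` state whose embedding heads a checked v8 table (external rows certified) is a LOCAL A-win over the field `L` of
characteristic 3.** OURS. [folklore] -/
theorem rWins_liftState_of_pcert8B (L : Type) [Field L] [CharP L 3] [DecidableEq L] {ext : List (Terms 5 (ZMod 3))}
    (hext : ∀ T5 ∈ ext, (∀ β : L, β ≠ 0 → ∀ (r : Fin 4 →₀ ℕ) (exc : Finset (Fin 4)),
      RWins 3 localB (⟨spec (φ3 L) β (evalT T5), r, exc⟩ : State L)))
    {s : SData 4 (ZMod 3)} {cert : PRowCert8 (ZMod 3)} {rest : List (PRow8 (ZMod 3))}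
    (h : pcert8B 3 ext ((embed s.L, cert) :: rest) = true) : RWins 3 localB (liftState L s.toState) := by
  have hw := pwin_of_pcert8B (φ3 L) (by norm_num) hext h (embed s.L, cert) List.mem_cons_self 1 one_ne_zero
    (expo s.r) s.exc
  rw [spec_embed] at hw
  exact hw

end LoopCLocal

end Summit.ResolutionOfSingularities.ResolutionOfSingularities.Theorems.PIDim4

end
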